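import Literature.Combinatorics.LorentzianPolynomials.Basic
import HarnessLib

/-!
# Bivariate Lorentzian polynomials: `Σ_k a_k w_1^k w_2^{d-k}` is Lorentzian iff `(a_k)` is ultra log-concave with no
# internal zeros (Brändén–Huh 2020, Example 2.26)

Layer `Literature/Combinatorics/LorentzianPolynomials`, namespace `Literature.Combinatorics.LorentzianPolynomials`;
lane `lit-hodgefound` (Track 2 foundations library), seat p16, generation 27 (row g27-#6). Sequel of `Basic.lean` (row
g27-#1: `IsMConvex`, `normCoeff` (`c_α = α! coeff_α`), `iterPderiv` (`∂^α`), `hessian`, `lorentzian σ d` = `L^d_n` by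
Brändén–Huh's Definition 2.6, its second form `mem_lorentzian_iff_forall_iterPderiv`, and Proposition 4.4
`normCoeff_sq_ge`: `c_α² ≥ c_{α+e_i-e_j} c_{α-e_i+e_j}` on `L^d_n`).

## Source (verbatim) — P. Brändén, J. Huh, *Lorentzian polynomials* [BrandenHuh2019] (held `paper:arxiv-1902.03719`)

* §2.1 **Example 2.3**: "Consider the homogeneous bivariate polynomial with positive coefficients `f = Σ_{k=0}^d a_k w_1^k w_2^{d-k}`.
  Computing the partial derivatives of `f` reveals that `f` is strictly Lorentzian if and only if
  `a_k² / C(d,k)² > (a_{k-1}/C(d,k-1)) (a_{k+1}/C(d,k+1))` for all `0 < k < d`."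
* §2.4 **Example 2.26**: "A sequence of nonnegative numbers `a_0, a_1, …, a_d` is said to be ultra log-concave if
  `a_k² / C(d,k)² ≥ (a_{k-1}/C(d,k-1)) (a_{k+1}/C(d,k+1))` for all `0 < k < d`. The sequence is said to have no internal
  zeros if `a_{k_1} a_{k_3} > 0 ⟹ a_{k_2} > 0` for all `0 ≤ k_1 < k_2 < k_3 ≤ d`. […] Theorem 2.25 says that […] the
  polynomial `Σ_{k=0}^d a_k w_1^k w_2^{d-k}` is Lorentzian if and only if the sequence `a_k` is nonnegative, ultra log-concave,
  and has no internal zeros."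
* §2.2 (p. 11): M-convex sets (exchange property), Definition 2.6 (`L^d_n`); §4.1 Proposition 4.4 and its proof
  ("Substituting `w_k` by zero for all `k` other than `i` and `j`, we get the bivariate quadratic polynomial
  `½ c_{α+e_i-e_j} w_i² + c_α w_i w_j + ½ c_{α-e_i+e_j} w_j²` […] hence `c_α² ≥ c_{α+e_i-e_j} c_{α-e_i+e_j}`").

## What is here (two variables `w_0, w_1`, indexed by `Fin 2`; `d` the degree; `a : ℕ → ℝ` the coefficient sequence)

* §1 `bideg k l = k e_0 + l e_1 ∈ ℕ^{Fin 2}` (`eq_bideg`: every exponent is one), `degree_bideg`, `factorialProd_bideg`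
  (`(k,l)! = k! l!`), `bideg_sub_single_…` (the shifts `α ∓ e_0 ± e_1`).
* §2 the printed notions `IsUltraLogConcave d a`, `HasNoInternalZeros d a`; the form
  **`bivariate d a = Σ_{k ≤ d} a_k w_0^k w_1^{d-k}`** (`bivariate_eq_sum`), `coeff_bivariate`, **`normCoeff_bivariate_bideg`**
  (`c_{(k,d-k)} = k!(d-k)! a_k = d! · a_k / C(d,k)`), `isHomogeneous_bivariate`, `support_bivariate`, and
  `eq_bivariate_of_isHomogeneous` (every `f ∈ H^d_2` is `bivariate d (k ↦ coeff_{(k,d-k)} f)`);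
  **`isUltraLogConcave_iff_normCoeff`**: ultra log-concavity of `(a_k)` is log-concavity `c_{k-1} c_{k+1} ≤ c_k²` of the
  normalized coefficients.
* §3 **`isMConvex_iff_forall_between`**: a subset `{(k, n-k) : P k}` of `Δ^n_2` is M-convex iff `P` holds between any two
  places where it holds (the M-convex subsets of a segment are its sub-segments) — "no internal zeros".
* §4 **`sigPos_le_one_of_mul_le_sq`**: a symmetric `2 × 2` matrix `((p, q), (q, r))` with `p r ≤ q²` has at most one
  positive eigenvalue (Sylvester: a positive definite plane would contain `(q, -p)`).
* §5 **`bivariate_mem_lorentzian_iff`** (Example 2.26): for `a_k ≥ 0`,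
  `Σ_k a_k w_0^k w_1^{d-k} ∈ L^d_2 ⟺ (a_k)` ultra log-concave with no internal zeros — `⟹` by Prop. 4.4 (`normCoeff_sq_ge`)
  and the M-convexity of the support; `⟸` by the second form of Def. 2.6: each `∂^α f`, `|α| = d-2`, is a bivariate
  quadratic with Hessian `((c_{k+2}, c_{k+1}), (c_{k+1}, c_k))`, hyperbolic by ultra log-concavity, with support a segment
  by the no-internal-zeros condition; and **`mem_lorentzian_iff_of_isHomogeneous`** (the same for any `f ∈ H^d_2` with
  nonnegative coefficients).

Four definitions with bodies (`bideg`, `IsUltraLogConcave`, `HasNoInternalZeros`, `bivariate`), theorems otherwise; no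
`sorry`, no named fact (net debt 0). NOT claimed: the STRICT version (Example 2.3; strictly Lorentzian polynomials are not
in the tree).

## References

* [BrandenHuh2019] P. Brändén, J. Huh, *Lorentzian polynomials*, Ann. of Math. (2) 192 (2020) 821–891, arXiv:1902.03719 —
  §2.1 Example 2.3; §2.2 (p. 11), Def. 2.6; §2.4 Thm. 2.25, Example 2.26; §4.1 Prop. 4.4.
-/

noncomputable section

open MvPolynomial Finsupp Finset
open scoped Nat

namespace Literature.Combinatorics.LorentzianPolynomials

/-! ## §1 Exponents `(k, l) = k e_0 + l e_1` in two variables -/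

section Bideg

/-- **The exponent `(k, l) = k e_0 + l e_1 ∈ ℕ²`** of the monomial `w_0^k w_1^l` (Brändén–Huh's `w_1^k w_2^{d-k}` has exponent
`(k, d-k)`). [cite: BrandenHuh2019, §2.4 Example 2.26 ("`Σ_{k=0}^d a_k w_1^k w_2^{d-k}`")] -/
def bideg (k l : ℕ) : Fin 2 →₀ ℕ := Finsupp.single 0 k + Finsupp.single 1 l

/-- `(k, l) = k e_0 + l e_1`. [cite: BrandenHuh2019, §2.4 Example 2.26] -/
theorem bideg_def (k l : ℕ) : bideg k l = Finsupp.single 0 k + Finsupp.single 1 l := rfl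

/-- `(k, l)_0 = k`. [cite: BrandenHuh2019, §2.4 Example 2.26] -/
@[simp] theorem bideg_apply_zero (k l : ℕ) : bideg k l 0 = k := by
  simp [bideg]

/-- `(k, l)_1 = l`. [cite: BrandenHuh2019, §2.4 Example 2.26] -/
@[simp] theorem bideg_apply_one (k l : ℕ) : bideg k l 1 = l := by
  simp [bideg]

/-- Every exponent in two variables is `(α_0, α_1)`. [cite: BrandenHuh2019, §2.4 Example 2.26 ("bivariate")] -/
theorem eq_bideg (α : Fin 2 →₀ ℕ) : α = bideg (α 0) (α 1) := by
  ext i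
  fin_cases i <;> simp

/-- `(k, l) = (k', l') ↔ k = k' ∧ l = l'`. [cite: BrandenHuh2019, §2.4 Example 2.26] -/
theorem bideg_eq_bideg_iff {k l k' l' : ℕ} : bideg k l = bideg k' l' ↔ k = k' ∧ l = l' := by
  constructor
  · intro h
    exact ⟨by simpa using congr_arg (fun β ↦ β 0) h, by simpa using congr_arg (fun β ↦ β 1) h⟩
  · rintro ⟨rfl, rfl⟩; rfl

/-- `|(k, l)| = k + l`. [cite: BrandenHuh2019, §2.4 Example 2.26 ("homogeneous")] -/
theorem degree_bideg (k l : ℕ) : (bideg k l).degree = k + l := by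
  rw [bideg, map_add, Finsupp.degree_single, Finsupp.degree_single]

/-- `|α| = α_0 + α_1` in two variables. [cite: BrandenHuh2019, §2.4 Example 2.26] -/
theorem degree_eq_add (α : Fin 2 →₀ ℕ) : α.degree = α 0 + α 1 := by
  conv_lhs => rw [eq_bideg α]
  exact degree_bideg _ _

/-- `(k, l)! = k! l!`. [cite: BrandenHuh2019, §2.2 (p. 11, "`α! = Π_i α_i!`")] -/
theorem factorialProd_bideg (k l : ℕ) : factorialProd (bideg k l) = k ! * l ! := by
  rw [factorialProd, Fin.prod_univ_two, bideg_apply_zero, bideg_apply_one]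

/-- `(k, l) + (k', l') = (k + k', l + l')`. [cite: BrandenHuh2019, §2.4 Example 2.26] -/
theorem bideg_add_bideg (k l k' l' : ℕ) : bideg k l + bideg k' l' = bideg (k + k') (l + l') := by
  rw [eq_bideg (bideg k l + bideg k' l')]
  simp

/-- `e_0 = (1, 0)`. [cite: BrandenHuh2019, §2.2 (p. 11, "`e_i`")] -/
theorem single_zero_one : Finsupp.single (0 : Fin 2) 1 = bideg 1 0 := by
  rw [eq_bideg (Finsupp.single 0 1)]; simp

/-- `e_1 = (0, 1)`. [cite: BrandenHuh2019, §2.2 (p. 11, "`e_i`")] -/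
theorem single_one_one : Finsupp.single (1 : Fin 2) 1 = bideg 0 1 := by
  rw [eq_bideg (Finsupp.single 1 1)]; simp

/-- `(k, l) - e_0 + e_1 = (k - 1, l + 1)` (truncated subtraction). [cite: BrandenHuh2019, §4.1 Prop. 4.4 ("`α - e_i + e_j`")] -/
theorem bideg_sub_single_zero_add_single_one (k l : ℕ) :
    bideg k l - Finsupp.single 0 1 + Finsupp.single 1 1 = bideg (k - 1) (l + 1) := by
  rw [eq_bideg (bideg k l - Finsupp.single 0 1 + Finsupp.single 1 1)]
  simp

/-- `(k, l) - e_1 + e_0 = (k + 1, l - 1)` (truncated subtraction). [cite: BrandenHuh2019, §4.1 Prop. 4.4 ("`α - e_i + e_j`")] -/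
theorem bideg_sub_single_one_add_single_zero (k l : ℕ) :
    bideg k l - Finsupp.single 1 1 + Finsupp.single 0 1 = bideg (k + 1) (l - 1) := by
  rw [eq_bideg (bideg k l - Finsupp.single 1 1 + Finsupp.single 0 1)]
  simp

end Bideg

/-! ## §2 Ultra log-concave sequences, internal zeros, and the bivariate form `Σ_k a_k w_0^k w_1^{d-k}` -/

section Sequences

/-- **Ultra log-concave sequence** `a_0, …, a_d`: "`a_k² / C(d,k)² ≥ (a_{k-1}/C(d,k-1)) · (a_{k+1}/C(d,k+1))` for all
`0 < k < d`". [cite: BrandenHuh2019, §2.4 Example 2.26] -/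
def IsUltraLogConcave (d : ℕ) (a : ℕ → ℝ) : Prop :=
  ∀ k, 0 < k → k < d → (a (k - 1) / d.choose (k - 1)) * (a (k + 1) / d.choose (k + 1)) ≤ (a k / d.choose k) ^ 2

/-- **No internal zeros**: "`a_{k_1} a_{k_3} > 0 ⟹ a_{k_2} > 0` for all `0 ≤ k_1 < k_2 < k_3 ≤ d`".
[cite: BrandenHuh2019, §2.4 Example 2.26] -/
def HasNoInternalZeros (d : ℕ) (a : ℕ → ℝ) : Prop :=
  ∀ k₁ k₂ k₃, k₁ < k₂ → k₂ < k₃ → k₃ ≤ d → 0 < a k₁ * a k₃ → 0 < a k₂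

/-- `IsUltraLogConcave` unfolded. [cite: BrandenHuh2019, §2.4 Example 2.26] -/
theorem isUltraLogConcave_iff {d : ℕ} {a : ℕ → ℝ} : IsUltraLogConcave d a ↔
    ∀ k, 0 < k → k < d → (a (k - 1) / d.choose (k - 1)) * (a (k + 1) / d.choose (k + 1)) ≤ (a k / d.choose k) ^ 2 :=
  Iff.rfl

/-- `HasNoInternalZeros` unfolded. [cite: BrandenHuh2019, §2.4 Example 2.26] -/
theorem hasNoInternalZeros_iff {d : ℕ} {a : ℕ → ℝ} : HasNoInternalZeros d a ↔
    ∀ k₁ k₂ k₃, k₁ < k₂ → k₂ < k₃ → k₃ ≤ d → 0 < a k₁ * a k₃ → 0 < a k₂ :=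
  Iff.rfl

/-- For a nonnegative sequence, "no internal zeros" is the statement that the nonvanishing set is a segment.
[cite: BrandenHuh2019, §2.4 Example 2.26] -/
theorem hasNoInternalZeros_iff_ne_zero {d : ℕ} {a : ℕ → ℝ} (ha : ∀ k ≤ d, 0 ≤ a k) : HasNoInternalZeros d a ↔
    ∀ k₁ k₂ k₃, k₁ < k₂ → k₂ < k₃ → k₃ ≤ d → a k₁ ≠ 0 → a k₃ ≠ 0 → a k₂ ≠ 0 := by
  refine forall₃_congr fun k₁ k₂ k₃ ↦ forall₃_congr fun h12 h23 h3 ↦ ?_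
  have h1 := ha k₁ (by omega)
  have h2 := ha k₂ (by omega)
  have h3' := ha k₃ h3
  rw [mul_pos_iff_of_pos_left' h1 h3']
  constructor
  · intro h hk1 hk3
    exact (h ⟨lt_of_le_of_ne h1 (Ne.symm hk1), lt_of_le_of_ne h3' (Ne.symm hk3)⟩).ne'
  · intro h ⟨hk1, hk3⟩
    exact lt_of_le_of_ne h2 (Ne.symm (h hk1.ne' hk3.ne'))
  where
  /-- `0 < x y ↔ 0 < x ∧ 0 < y` for `x, y ≥ 0`. [folklore] -/
  mul_pos_iff_of_pos_left' {x y : ℝ} (hx : 0 ≤ x) (hy : 0 ≤ y) : 0 < x * y ↔ 0 < x ∧ 0 < y := by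
    constructor
    · intro h
      refine ⟨lt_of_le_of_ne hx fun h0 ↦ ?_, lt_of_le_of_ne hy fun h0 ↦ ?_⟩ <;> simp [← h0] at h
    · exact fun ⟨h1, h2⟩ ↦ mul_pos h1 h2

/-- **The bivariate form of a sequence**: `Σ_{k=0}^d a_k w_0^k w_1^{d-k} ∈ ℝ[w_0, w_1]` (Brändén–Huh's
`Σ_k a_k w_1^k w_2^{d-k}`). [cite: BrandenHuh2019, §2.4 Example 2.26] -/
def bivariate (d : ℕ) (a : ℕ → ℝ) : MvPolynomial (Fin 2) ℝ :=
  ∑ k ∈ range (d + 1), monomial (bideg k (d - k)) (a k)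

/-- `bivariate d a` unfolded. [cite: BrandenHuh2019, §2.4 Example 2.26] -/
theorem bivariate_def (d : ℕ) (a : ℕ → ℝ) : bivariate d a = ∑ k ∈ range (d + 1), monomial (bideg k (d - k)) (a k) := rfl

/-- `bivariate d a = Σ_{k ≤ d} a_k · w_0^k · w_1^{d-k}` written with `C`, `X`. [cite: BrandenHuh2019, §2.4 Example 2.26] -/
theorem bivariate_eq_sum (d : ℕ) (a : ℕ → ℝ) :
    bivariate d a = ∑ k ∈ range (d + 1), C (a k) * X 0 ^ k * X 1 ^ (d - k) := by
  refine Finset.sum_congr rfl fun k _ ↦ ?_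
  rw [C_apply, X_pow_eq_monomial, X_pow_eq_monomial, monomial_mul, monomial_mul, zero_add, mul_one, mul_one]
  rfl

/-- **The coefficients**: `coeff_β (Σ_k a_k w_0^k w_1^{d-k}) = a_{β_0}` if `|β| = d`, else `0`. [cite: BrandenHuh2019, §2.4
Example 2.26] -/
theorem coeff_bivariate (d : ℕ) (a : ℕ → ℝ) (β : Fin 2 →₀ ℕ) :
    coeff β (bivariate d a) = if β.degree = d then a (β 0) else 0 := by
  rw [bivariate, coeff_sum]
  simp_rw [coeff_monomial]
  have hβ := degree_eq_add β
  split_ifs with h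
  · rw [Finset.sum_eq_single_of_mem (β 0) (mem_range.2 (by omega))]
    · rw [if_pos]
      rw [eq_bideg β, bideg_apply_zero, bideg_eq_bideg_iff]
      exact ⟨rfl, by omega⟩
    · intro k _ hk
      refine if_neg fun h' ↦ hk ?_
      rw [← h', bideg_apply_zero]
  · refine Finset.sum_eq_zero fun k hk ↦ if_neg fun h' ↦ h ?_
    rw [← h', degree_bideg]
    have := mem_range.1 hk
    omega

/-- `coeff_{(k, d-k)} = a_k`. [cite: BrandenHuh2019, §2.4 Example 2.26] -/
theorem coeff_bivariate_bideg (a : ℕ → ℝ) {d k : ℕ} (hk : k ≤ d) : coeff (bideg k (d - k)) (bivariate d a) = a k := by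
  rw [coeff_bivariate, if_pos (by rw [degree_bideg]; omega), bideg_apply_zero]

/-- **The normalized coefficients**: `c_{(k, d-k)} = k! (d-k)! · a_k`. [cite: BrandenHuh2019, §2.2 (p. 11, `f = Σ (c_α/α!) w^α`);
§2.4 Example 2.26] -/
theorem normCoeff_bivariate_bideg (a : ℕ → ℝ) {d k : ℕ} (hk : k ≤ d) :
    normCoeff (bideg k (d - k)) (bivariate d a) = k ! * (d - k)! * a k := by
  rw [normCoeff, factorialProd_bideg, coeff_bivariate_bideg a hk]

/-- `c_β = β_0! β_1! · a_{β_0}` if `|β| = d`, else `0`. [cite: BrandenHuh2019, §2.2 (p. 11); §2.4 Example 2.26] -/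
theorem normCoeff_bivariate (d : ℕ) (a : ℕ → ℝ) (β : Fin 2 →₀ ℕ) :
    normCoeff β (bivariate d a) = if β.degree = d then (β 0)! * (β 1)! * a (β 0) else 0 := by
  rw [normCoeff, coeff_bivariate]
  split_ifs with h
  · rw [show factorialProd β = (β 0)! * (β 1)! from by
      conv_lhs => rw [eq_bideg β]
      exact factorialProd_bideg _ _]
  · rw [mul_zero]

/-- `k!(d-k)! = d!/C(d,k)` in `ℝ`. [cite: BrandenHuh2019, §2.4 Example 2.26 (the binomial normalisation `a_k/C(d,k)`)] -/
theorem factorial_mul_factorial_eq_div {d k : ℕ} (hk : k ≤ d) : ((k ! : ℕ) : ℝ) * (d - k)! = d ! / d.choose k := by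
  have h := Nat.choose_mul_factorial_mul_factorial hk
  have hc : (d.choose k : ℝ) ≠ 0 := Nat.cast_ne_zero.2 (Nat.choose_pos hk).ne'
  rw [eq_div_iff hc, ← h]
  push_cast
  ring

/-- `Σ_k a_k w_0^k w_1^{d-k}` is homogeneous of degree `d`. [cite: BrandenHuh2019, §2.4 Example 2.26 ("bivariate homogeneous
polynomial")] -/
theorem isHomogeneous_bivariate (d : ℕ) (a : ℕ → ℝ) : (bivariate d a).IsHomogeneous d := by
  rw [bivariate]
  exact IsHomogeneous.sum _ _ _ fun k hk ↦ isHomogeneous_monomial _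
    (by rw [degree_bideg]; have := mem_range.1 hk; omega)

/-- Nonnegative sequences give nonnegative coefficients. [cite: BrandenHuh2019, §2.4 Example 2.26 ("nonnegative")] -/
theorem coeff_bivariate_nonneg {d : ℕ} {a : ℕ → ℝ} (ha : ∀ k ≤ d, 0 ≤ a k) (β : Fin 2 →₀ ℕ) :
    0 ≤ coeff β (bivariate d a) := by
  rw [coeff_bivariate]
  split_ifs with h
  · exact ha _ (by have := degree_eq_add β; omega)
  · exact le_rfl

/-- **The support** of `Σ_k a_k w_0^k w_1^{d-k}` is `{(k, d-k) : a_k ≠ 0}`. [cite: BrandenHuh2019, §2.4 Example 2.26; §2.2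
(p. 11, "The support of the polynomial `f`")] -/
theorem support_bivariate (d : ℕ) (a : ℕ → ℝ) :
    {β : Fin 2 →₀ ℕ | coeff β (bivariate d a) ≠ 0} = {β | β.degree = d ∧ a (β 0) ≠ 0} := by
  ext β
  rw [Set.mem_setOf_eq, Set.mem_setOf_eq, coeff_bivariate]
  split_ifs with h
  · exact ⟨fun h' ↦ ⟨h, h'⟩, fun h' ↦ h'.2⟩
  · simp [h]

/-- **Every homogeneous bivariate polynomial of degree `d` is `Σ_k a_k w_0^k w_1^{d-k}`** with `a_k = coeff_{(k, d-k)} f`.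
[cite: BrandenHuh2019, §2.4 Example 2.26 ("a bivariate homogeneous polynomial `Σ_{k=0}^d a_k w_1^k w_2^{d-k}`")] -/
theorem eq_bivariate_of_isHomogeneous {d : ℕ} {f : MvPolynomial (Fin 2) ℝ} (hf : f.IsHomogeneous d) :
    f = bivariate d fun k ↦ coeff (bideg k (d - k)) f := by
  ext β
  rw [coeff_bivariate]
  split_ifs with h
  · have hβ := degree_eq_add β
    rw [show bideg (β 0) (d - β 0) = β by rw [eq_bideg β, bideg_apply_zero, bideg_eq_bideg_iff]; omega]
  · exact hf.coeff_eq_zero h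

end Sequences

/-! ## §3 M-convex subsets of the segment `Δ^n_2` are its sub-segments ("no internal zeros") -/

section Segment

/-- An index in two variables is `0` or `1`. [folklore] -/
private theorem fin_two_eq (i : Fin 2) : i = 0 ∨ i = 1 := by
  match i with
  | 0 => exact Or.inl rfl
  | 1 => exact Or.inr rfl

/-- **The M-convex subsets of `Δ^n_2 = {(k, n-k)}` are exactly the sub-segments**: `{(k, n-k) : P(k)}` is M-convex iff
`P(k_1), P(k_3), k_1 < k_2 < k_3 ≤ n ⟹ P(k_2)` (the exchange `α - e_0 + e_1 = (k-1, n-k+1)` walks down a segment).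
[cite: BrandenHuh2019, §2.2 (p. 11, exchange property for M-convex sets); §2.4 Example 2.26 ("no internal zeros")] -/
theorem isMConvex_iff_forall_between {n : ℕ} {P : ℕ → Prop} :
    IsMConvex {β : Fin 2 →₀ ℕ | β.degree = n ∧ P (β 0)} ↔
      ∀ k₁ k₂ k₃, k₁ < k₂ → k₂ < k₃ → k₃ ≤ n → P k₁ → P k₃ → P k₂ := by
  constructor
  · intro hM k₁ k₂ k₃ h12 h23 h3 hP1 hP3
    -- walk down from `k₃` to `k₂` by exchanges against `(k₁, n - k₁)`
    suffices h : ∀ m k, k + m = k₃ → k₁ ≤ k → P k from h (k₃ - k₂) k₂ (by omega) h12.le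
    intro m
    induction m with
    | zero => intro k hk _; rw [add_zero] at hk; exact hk ▸ hP3
    | succ m ih =>
      intro k hk hk1
      have hPk1 : P (k + 1) := ih (k + 1) (by omega) (by omega)
      have hα : bideg (k + 1) (n - (k + 1)) ∈ {β : Fin 2 →₀ ℕ | β.degree = n ∧ P (β 0)} :=
        ⟨by rw [degree_bideg]; omega, by rwa [bideg_apply_zero]⟩
      have hβ : bideg k₁ (n - k₁) ∈ {β : Fin 2 →₀ ℕ | β.degree = n ∧ P (β 0)} :=
        ⟨by rw [degree_bideg]; omega, by rwa [bideg_apply_zero]⟩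
      obtain ⟨j, hj, hmem⟩ := hM hα hβ 0 (by rw [bideg_apply_zero, bideg_apply_zero]; omega)
      rcases fin_two_eq j with rfl | rfl
      · rw [bideg_apply_zero, bideg_apply_zero] at hj; omega
      · rw [bideg_sub_single_zero_add_single_one] at hmem
        simpa using hmem.2
  · intro h α β ⟨hαd, hαP⟩ ⟨hβd, hβP⟩ i hi
    have hα := degree_eq_add α
    have hβ := degree_eq_add β
    rcases fin_two_eq i with rfl | rfl
    · -- `α_0 > β_0`: exchange towards `e_1`
      refine ⟨1, by omega, ?_, ?_⟩
      · rw [degree_sub_single_add_single (by omega), hαd]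
      · rw [eq_bideg α, bideg_sub_single_zero_add_single_one, bideg_apply_zero]
        by_cases hk : α 0 - 1 = β 0
        · rw [hk]; exact hβP
        · exact h (β 0) (α 0 - 1) (α 0) (by omega) (by omega) (by omega) hβP hαP
    · -- `α_1 > β_1`: exchange towards `e_0`
      refine ⟨0, by omega, ?_, ?_⟩
      · rw [degree_sub_single_add_single (by omega), hαd]
      · rw [eq_bideg α, bideg_sub_single_one_add_single_zero, bideg_apply_zero]
        by_cases hk : α 0 + 1 = β 0
        · rw [hk]; exact hβP
        · exact h (α 0) (α 0 + 1) (β 0) (by omega) (by omega) (by omega) hαP hβP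

end Segment

/-! ## §4 A `2 × 2` symmetric matrix with `p r ≤ q²` has at most one positive eigenvalue -/

section TwoByTwo

/-- **`((p, q), (q, r))` with `p r ≤ q²` has at most one positive eigenvalue** (`sigPos ≤ 1`): were the form positive
definite on the plane (Sylvester: `sigPos = 2`), then `p = Q(e_0) > 0` and `Q(q, -p) = p (p r - q²) ≤ 0` — a contradiction.
This is the `2 × 2` case of "`∂^α f` has at most one positive eigenvalue" read through `c_α² ≥ c_{α+e_i-e_j} c_{α-e_i+e_j}`.
[cite: BrandenHuh2019, §2.1 Example 2.3 ("Computing the partial derivatives of `f` reveals […]"); §4.1 proof of Prop. 4.4]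
-/
theorem sigPos_le_one_of_mul_le_sq {M : Matrix (Fin 2) (Fin 2) ℝ} (hM : M.IsSymm) (h : M 0 0 * M 1 1 ≤ M 0 1 ^ 2) :
    sigPos (Matrix.toBilin' M).toQuadraticMap ≤ 1 := by
  set Q := (Matrix.toBilin' M).toQuadraticMap with hQ
  have hQx : ∀ x : Fin 2 → ℝ, Q x = x 0 * M 0 0 * x 0 + x 0 * M 0 1 * x 1 + x 1 * M 0 1 * x 0 + x 1 * M 1 1 * x 1 := by
    intro x
    rw [hQ, LinearMap.BilinMap.toQuadraticMap_apply, Matrix.toBilin'_apply, Fin.sum_univ_two, Fin.sum_univ_two,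
      Fin.sum_univ_two, hM.apply 0 1]
    ring
  by_contra hlt
  push Not at hlt
  obtain ⟨V, hV, hpos⟩ := exists_finrank_eq_sigPos_and_posDef Q
  have hfin : Module.finrank ℝ (Fin 2 → ℝ) = 2 := by simp
  have hVtop : V = ⊤ := Submodule.eq_top_of_finrank_eq (by
    rw [hfin]; have := Submodule.finrank_le V; rw [hfin] at this; omega)
  have hposQ : ∀ x : Fin 2 → ℝ, x ≠ 0 → 0 < Q x := fun x hx ↦ by
    have hx' := hpos ⟨x, hVtop ▸ Submodule.mem_top⟩ (by
      intro h0; exact hx (by simpa using congr_arg Subtype.val h0))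
    simpa [QuadraticMap.restrict_apply] using hx'
  -- `p > 0`
  have hp : 0 < M 0 0 := by
    have h0 := hposQ (Pi.single 0 1) (by simp)
    rw [hQx] at h0
    simpa using h0
  -- `Q(q, -p) = p (p r - q²) ≤ 0`
  have hv : (![M 0 1, -M 0 0] : Fin 2 → ℝ) ≠ 0 := by
    intro h0
    have := congr_fun h0 1
    simp only [Matrix.cons_val_one, Matrix.cons_val_fin_one, Pi.zero_apply, neg_eq_zero] at this
    exact hp.ne' this
  have h1 := hposQ _ hv
  rw [hQx] at h1
  simp only [Matrix.cons_val_zero, Matrix.cons_val_one, Matrix.cons_val_fin_one] at h1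
  have h2 : M 0 1 * M 0 0 * M 0 1 + M 0 1 * M 0 1 * -M 0 0 + -M 0 0 * M 0 1 * M 0 1 + -M 0 0 * M 1 1 * -M 0 0 =
      M 0 0 * (M 0 0 * M 1 1 - M 0 1 ^ 2) := by ring
  rw [h2] at h1
  exact absurd h1 (not_lt.2 (mul_nonpos_of_nonneg_of_nonpos hp.le (sub_nonpos.2 h)))

end TwoByTwo

/-! ## §5 Example 2.26: `Σ_k a_k w_0^k w_1^{d-k} ∈ L^d_2 ⟺ (a_k)` ultra log-concave with no internal zeros -/

section Main

/-- **Ultra log-concavity is log-concavity of the normalized coefficients**: with `c_k = c_{(k,d-k)} = d! · a_k / C(d,k)`,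
`(a_k/C(d,k))² ≥ (a_{k-1}/C(d,k-1))(a_{k+1}/C(d,k+1)) ⟺ c_{k-1} c_{k+1} ≤ c_k²`. [cite: BrandenHuh2019, §2.4 Example 2.26;
§4.1 Prop. 4.4 ("`c_α² ≥ c_{α+e_i-e_j} c_{α-e_i+e_j}`")] -/
theorem isUltraLogConcave_iff_normCoeff {d : ℕ} {a : ℕ → ℝ} : IsUltraLogConcave d a ↔
    ∀ k, 0 < k → k < d →
      normCoeff (bideg (k - 1) (d - (k - 1))) (bivariate d a) * normCoeff (bideg (k + 1) (d - (k + 1))) (bivariate d a) ≤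
        normCoeff (bideg k (d - k)) (bivariate d a) ^ 2 := by
  refine forall₃_congr fun k hk hkd ↦ ?_
  rw [normCoeff_bivariate_bideg a (by omega), normCoeff_bivariate_bideg a (by omega), normCoeff_bivariate_bideg a hkd.le,
    factorial_mul_factorial_eq_div (by omega : k - 1 ≤ d), factorial_mul_factorial_eq_div (by omega : k + 1 ≤ d),
    factorial_mul_factorial_eq_div hkd.le]
  have hd : (0 : ℝ) < d ! := Nat.cast_pos.2 (Nat.factorial_pos d)
  rw [show (d ! : ℝ) / d.choose (k - 1) * a (k - 1) * ((d ! : ℝ) / d.choose (k + 1) * a (k + 1)) =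
      (d ! : ℝ) ^ 2 * ((a (k - 1) / d.choose (k - 1)) * (a (k + 1) / d.choose (k + 1))) by ring,
    show ((d ! : ℝ) / d.choose k * a k) ^ 2 = (d ! : ℝ) ^ 2 * (a k / d.choose k) ^ 2 by ring]
  exact ⟨fun h ↦ mul_le_mul_of_nonneg_left h (pow_pos hd 2).le, fun h ↦ le_of_mul_le_mul_left h (pow_pos hd 2)⟩

/-- `Π_j (γ_j)_{(α_j)} ≥ 0`: the falling-factorial factor of `coeff_β(∂^α f)`. [folklore] -/
private theorem descFactorialProd_nonneg {σ : Type*} [Fintype σ] (γ α : σ →₀ ℕ) : 0 ≤ descFactorialProd γ α :=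
  Finset.prod_nonneg fun _ _ ↦ Nat.cast_nonneg _

/-- `∂^α` of a polynomial with nonnegative coefficients has nonnegative coefficients. [cite: BrandenHuh2019, §2.2 (p. 11,
"`f ∈ M^d_n` implies `∂_i f ∈ M^{d-1}_n`")] -/
theorem coeff_iterPderiv_nonneg {σ : Type*} [Fintype σ] {f : MvPolynomial σ ℝ} (hf : ∀ β, 0 ≤ coeff β f) (α β : σ →₀ ℕ) :
    0 ≤ coeff β (iterPderiv α f) := by
  rw [coeff_iterPderiv]
  exact mul_nonneg (descFactorialProd_nonneg _ _) (hf _)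

/-- The support of `∂^α (Σ_k a_k w_0^k w_1^{d-k})`, `|α| = d - 2`, is the segment `{(k, 2-k) : a_{α_0+k} ≠ 0}` of `Δ²_2`.
[cite: BrandenHuh2019, §4.1 proof of Prop. 4.4 ("the bivariate quadratic polynomial
`½ c_{α+e_i-e_j} w_i² + c_α w_i w_j + ½ c_{α-e_i+e_j} w_j²`")] -/
theorem support_iterPderiv_bivariate {d m : ℕ} (a : ℕ → ℝ) (hd : d = m + 2) {α : Fin 2 →₀ ℕ} (hα : α.degree = m) :
    {β : Fin 2 →₀ ℕ | coeff β (iterPderiv α (bivariate d a)) ≠ 0} = {β | β.degree = 2 ∧ a (α 0 + β 0) ≠ 0} := by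
  ext β
  simp only [Set.mem_setOf_eq]
  have key : coeff β (iterPderiv α (bivariate d a)) ≠ 0 ↔ normCoeff (α + β) (bivariate d a) ≠ 0 := by
    rw [← normCoeff_iterPderiv, ne_eq, ne_eq, normCoeff_eq_zero_iff]
  rw [key, normCoeff_bivariate, map_add, hα, Finsupp.add_apply]
  split_ifs with h
  · have h2 : β.degree = 2 := by omega
    constructor
    · intro h'
      exact ⟨h2, fun h0 ↦ h' (by rw [h0, mul_zero])⟩
    · rintro ⟨-, h'⟩
      exact mul_ne_zero (mul_ne_zero (Nat.cast_ne_zero.2 (Nat.factorial_ne_zero _))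
        (Nat.cast_ne_zero.2 (Nat.factorial_ne_zero _))) h'
  · constructor
    · intro h'; exact absurd rfl h'
    · rintro ⟨h2, -⟩; omega

/-- The Hessian of `∂^α (Σ_k a_k w_0^k w_1^{d-k})`, `α = (k, d-2-k)`, is `((c_{k+2}, c_{k+1}), (c_{k+1}, c_k))` with
`c_j = c_{(j, d-j)}`. [cite: BrandenHuh2019, §4.1 proof of Prop. 4.4; Prop. 4.5 ("`v_i^T 𝓗 v_j = D_i D_j D_3 ⋯ D_d f`")] -/
theorem hessian_iterPderiv_bivariate {d m : ℕ} (a : ℕ → ℝ) (hd : d = m + 2) {α : Fin 2 →₀ ℕ} (hα : α.degree = m) :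
    hessian (iterPderiv α (bivariate d a)) 0 0 = normCoeff (bideg (α 0 + 2) (d - (α 0 + 2))) (bivariate d a) ∧
    hessian (iterPderiv α (bivariate d a)) 0 1 = normCoeff (bideg (α 0 + 1) (d - (α 0 + 1))) (bivariate d a) ∧
    hessian (iterPderiv α (bivariate d a)) 1 1 = normCoeff (bideg (α 0) (d - α 0)) (bivariate d a) := by
  have hα' := degree_eq_add α
  refine ⟨?_, ?_, ?_⟩ <;> rw [hessian_iterPderiv] <;> congr 1 <;> rw [eq_bideg α] <;>
    simp only [single_zero_one, single_one_one, bideg_add_bideg, bideg_apply_zero, bideg_eq_bideg_iff, add_zero,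
      true_and] <;> omega

/-- **Brändén–Huh, Example 2.26.** For a nonnegative sequence `a_0, …, a_d`, the bivariate form `Σ_{k=0}^d a_k w_0^k w_1^{d-k}`
is Lorentzian (`∈ L^d_2`, Definition 2.6) **if and only if** `(a_k)` is ultra log-concave and has no internal zeros.
`⟹`: Prop. 4.4 (`c_{k-1} c_{k+1} ≤ c_k²`, tree `normCoeff_sq_ge`) is ultra log-concavity, and the M-convexity of the support
`{(k, d-k) : a_k ≠ 0}` is the absence of internal zeros (§3). `⟸`: by the second form of Def. 2.6 it suffices that every
`∂^α f`, `|α| = d - 2`, lies in `L²_2`: its support is a sub-segment of `Δ²_2` (no internal zeros) and its Hessian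
`((c_{k+2}, c_{k+1}), (c_{k+1}, c_k))` has `c_k c_{k+2} ≤ c_{k+1}²`, hence at most one positive eigenvalue (§4).
[cite: BrandenHuh2019, §2.4 Example 2.26; §2.1 Example 2.3; §4.1 Prop. 4.4] -/
theorem bivariate_mem_lorentzian_iff {d : ℕ} {a : ℕ → ℝ} (ha : ∀ k ≤ d, 0 ≤ a k) :
    bivariate d a ∈ lorentzian (Fin 2) d ↔ IsUltraLogConcave d a ∧ HasNoInternalZeros d a := by
  rw [hasNoInternalZeros_iff_ne_zero ha, ← isMConvex_iff_forall_between, ← support_bivariate]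
  match d with
  | 0 =>
    refine ⟨fun _ ↦ ⟨fun k hk hkd ↦ absurd hkd (by omega), ?_⟩,
      fun _ ↦ mem_lorentzian_zero.2 ⟨isHomogeneous_bivariate 0 a, coeff_bivariate_nonneg ha⟩⟩
    rw [support_bivariate]
    exact isMConvex_of_subset_degree_le_one zero_le_one fun β hβ ↦ hβ.1
  | 1 =>
    refine ⟨fun _ ↦ ⟨fun k hk hkd ↦ absurd hkd (by omega), ?_⟩,
      fun _ ↦ mem_lorentzian_one.2 ⟨isHomogeneous_bivariate 1 a, coeff_bivariate_nonneg ha⟩⟩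
    rw [support_bivariate]
    exact isMConvex_of_subset_degree_le_one le_rfl fun β hβ ↦ hβ.1
  | m + 2 =>
    constructor
    · intro hf
      refine ⟨isUltraLogConcave_iff_normCoeff.2 fun k hk hkd ↦ ?_, isMConvex_support_of_mem_lorentzian hf⟩
      have h := normCoeff_sq_ge hf (α := bideg k (m + 2 - k)) (by rw [degree_bideg]; omega) 0 1
      rwa [bideg_sub_single_zero_add_single_one, bideg_sub_single_one_add_single_zero,
        show m + 2 - k + 1 = m + 2 - (k - 1) by omega, show m + 2 - k - 1 = m + 2 - (k + 1) by omega] at h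
    · rintro ⟨hulc, hM⟩
      rw [support_bivariate, isMConvex_iff_forall_between (P := fun k ↦ a k ≠ 0)] at hM
      rw [isUltraLogConcave_iff_normCoeff] at hulc
      refine mem_lorentzian_iff_forall_iterPderiv.2 ⟨⟨isHomogeneous_bivariate _ a, coeff_bivariate_nonneg ha, ?_⟩,
        fun α hα ↦ mem_lorentzian_two.2 ⟨?_, coeff_iterPderiv_nonneg (coeff_bivariate_nonneg ha) α, ?_, ?_⟩⟩
      · rw [support_bivariate, isMConvex_iff_forall_between (P := fun k ↦ a k ≠ 0)]; exact hM
      · exact IsHomogeneous.iterPderiv α (by rw [hα, add_comm]; exact isHomogeneous_bivariate _ a)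
      · rw [support_iterPderiv_bivariate a rfl hα, isMConvex_iff_forall_between (P := fun k ↦ a (α 0 + k) ≠ 0)]
        have hα0 : α 0 ≤ m := by have := degree_eq_add α; omega
        intro k₁ k₂ k₃ h12 h23 h3 h1 h3'
        exact hM (α 0 + k₁) (α 0 + k₂) (α 0 + k₃) (by omega) (by omega) (by omega) h1 h3'
      · obtain ⟨h00, h01, h11⟩ := hessian_iterPderiv_bivariate a rfl hα
        have hα0 : α 0 ≤ m := by have := degree_eq_add α; omega
        refine sigPos_le_one_of_mul_le_sq (isSymm_hessian _) ?_
        rw [h00, h01, h11, mul_comm]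
        have h := hulc (α 0 + 1) (by omega) (by omega)
        rwa [Nat.add_sub_cancel, show α 0 + 1 + 1 = α 0 + 2 by omega] at h

/-- **Example 2.26 for an arbitrary bivariate form.** A homogeneous `f ∈ ℝ[w_0, w_1]` of degree `d` with nonnegative
coefficients is Lorentzian iff its coefficient sequence `a_k = coeff_{(k, d-k)} f` is ultra log-concave with no internal zeros.
[cite: BrandenHuh2019, §2.4 Example 2.26 ("a bivariate homogeneous polynomial […] is Lorentzian if and only if the sequence
`a_k` is nonnegative, ultra log-concave, and has no internal zeros")] -/
theorem mem_lorentzian_iff_of_isHomogeneous {d : ℕ} {f : MvPolynomial (Fin 2) ℝ} (hf : f.IsHomogeneous d)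
    (hnn : ∀ β, 0 ≤ coeff β f) :
    f ∈ lorentzian (Fin 2) d ↔ IsUltraLogConcave d (fun k ↦ coeff (bideg k (d - k)) f) ∧
      HasNoInternalZeros d (fun k ↦ coeff (bideg k (d - k)) f) := by
  conv_lhs => rw [eq_bivariate_of_isHomogeneous hf]
  exact bivariate_mem_lorentzian_iff fun k _ ↦ hnn _

end Main

end Literature.Combinatorics.LorentzianPolynomials

end
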